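/- Copyright: the b2b-balaban cell (near-miss cell 7), T⁴-continuum fan-out; row NE7b CRUX team (2), seat
t4-ne7b-formalise-leaf-02 (gen 31) — the E-side (key readings) part of the row OWNER's INTERFACE REQUEST NE7b IR-49-1
«THE FIBRE DECORATION» (RULING R-OWNER-49-1 (e), `CLAIMS.log` l.33479; SPEC v0∕v0.1 `CLAIMS.log` l.33613, §4 «what the
E-side owes for (ρ1)»; `HOME/INBOX.md` l.12792).  Released under the licence of the surrounding project. -/
import Summits.QuantumFields.BalabanUV.T4Continuum.Support.HistoryBankingFibreResum

/-!
# IR-49-1 «THE FIBRE DECORATION», KEY SIDE (1∕3): the decorations of a key member along its genealogy, their exact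
count, and the per-event choice words of the crude currency

Summits-side support leaf of the T⁴-continuum cell (rung (B)+1 on a FINITE torus only; NOT infinite volume, NOT the
mass gap, NOT the Clay statement; NOT a proof of the spine estimate NE7b — the cell's OWN estimate, NOT PRINTED, NOT
PROVED).  [folklore] finite combinatorics over the persistence dictionary's genealogies (`T4PersistenceDictionary.Gen`,
`Gen.events`), the owner's S25 node count (`HistoryBankingFibreResum.ncount`, `ncount_le_exp_nsum`,
`fibreMass_of_decoration`, `card_powerset_prod_powerset`, `two_pow_le_exp`, `four_pow_le_exp`), the key letters
(`HistoryPriceKeys.MULTOf`, `HistoryPriceNodeSum.nsum`) and the fibre of the key map (`T4LiveClassFibration.fibre`); no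
`structure`, no `[cite:]` tag, nothing printed asserted, no `Prop` fact minted, zero `sorry`.  B16 =
[Balaban1989LargeFieldII] is a manuscript UNDER AUDIT; (1.71)∕(1.72) pp. 378–379, p. 380 (the determining sets of a
large-field domain) and pp. 383∕384 (the count of the admissible sequences; the operation S) are quoted as LOCATORS of
hypothesis SHAPES only.  Siblings: `HistoryBankingFibreDecorWeighted` (2∕3, the weighted currency),
`HistoryBankingFibreDecorSlice` (3∕3, the slice of a term of M2-A's index and the reduced injectivity).

WHY.  After S25 (`HistoryBankingFibreResum`, owner gen 49) the located display (ρ) `FibreMass` of the (α) record — the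
field `hρ` of `HistReadDataL(W)` — is the conclusion of `fibreMass_of_decoration` from three primitive inputs: (ρ1) an
INJECTIVE per-member DECORATION of the key fibre (`Dec`, `dec`, a slice; displays `hmem`, `hinj`), (ρ2) the weight
FACTORISATION with a slice envelope, (ρ3) the PER-MEMBER decoration mass `Σ_{x ∈ Dec w} u w x ≤ exp (nsum φ w.2.1)`.
SPEC IR-49-1 asks the custodian (leaf-03) for the reading-level bundle `IndexDecor` + the record twin (§2∕§3∕§5 there),
and the E-side (this lineage) for WHAT THE DECORATION READS ON THE KEY (§4 there): per key member
`w = (root cell, genealogy G, physical datum)` and per EVENT of `G`, a word recording, level by level over the event's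
window, which cubes of the member carry the large fields of each type (print's determining sets, p. 380, inside the
component; `Z_j ∩ X` between events is determined by S, p. 384, hence no choice).  This file supplies that shape as
GENERIC KERNEL OBJECTS the custodian's fields can be instantiated with, and nothing else:
* THE DECORATION TYPE OF A MEMBER IS ITS OWN GENEALOGY DECORATED — `decG C G : Finset (Gen (ε × β))`, the genealogies
  of shape `G` (`gmap_fst_of_mem_decG`) whose every node `e` carries a letter of the displayed per-event choice set
  `C e` (`snd_mem_of_mem_decG`); its count is EXACTLY the owner's node count, `#(decG C G) = ncount (#C ·) G`
  (`card_decG_eq_ncount`), so SPEC §2's display `#(Dec w) ≤ ncount N w.2.1` is an EQUALITY at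
  `Dec K w := decG (C K w) w.2.1`, and (ρ3) in the crude currency (`u := 1`) is `card_decG_le_exp_nsum` from the
  per-event letters `#(C e) ≤ exp (φ e)` ON THE MEMBER's OWN EVENTS (`ncount_le_exp_nsum_of_events`; at a merger
  `sharpT = 0`, so the letter reads `#(C e) ≤ 1` there — the refuter's typing point T-49-1, PRICING-NE7b v18 F97, sits
  in the hypothesis, visibly);
* THE PER-EVENT CHOICE WORDS — `words S m` (words of length `m` over a finite alphabet, `#· = #S ^ m`), `subWords Q m`
  (one subset of the member's cube set `Q` per level, `2 ^ (#Q·m)`), `flagWords Q m` (a PAIR of subsets per level — the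
  pair `(Ω^c_j ∩ X, Z_j ∩ X)` of (1.71) at one level `j` —, `4 ^ (#Q·m)`), with the `exp` bounds from the share letters
  `#Q·m·log 2 ≤ φ` ∕ `#Q·m·log 4 ≤ φ` (FIBRE-1's shape: a bit cost per cube and level against the booked share);
* THE ASSEMBLED JUNCTION `fibreMass_of_genDecoration` (any term type): the owner's `fibreMass_of_decoration` at
  `Dec := decG`, `u := 1`, concluding LITERALLY `∑ τ ∈ fibre kmem T K k, dmass τ ≤ W * MULTOf φ k`, with remaining
  hypotheses {`dec`, `hmem`, `hinj`, a slice} — (ρ1), R-class — + {`v ≥ 0`, `Σ_{c ∈ Csl} v c ≤ W`,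
  `dmass τ ≤ v (slice τ)`} — (ρ2), PARAMETRIC, (ρ0) inside — + {`#(C w e) ≤ exp (φ e)` on the members' events} — (ρ3)'s
  letters, FIBRE-1.  Sibling 2∕3 does the weighted currency; sibling 3∕3 fixes the slice on M2-A's index.

WHAT.  §1 `words`, `card_words`, `length_eq_and_mem_of_mem_words`, `mem_words_of`; `subWords`, `flagWords`,
`card_subWords`, `card_flagWords`, `card_subWords_le_exp`, `card_flagWords_le_exp`, `card_flagWords_empty`.  §2 `decG`,
`card_decG_eq_ncount`, `gmap_fst_of_mem_decG`, `snd_mem_of_mem_decG`, `fst_mem_events_of_mem_decG`,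
`ncount_le_exp_nsum_of_events`, `ncount_mono_of_events`, `card_decG_le_exp_nsum`, `sum_one_decG_le_exp_nsum`.  §3 on a
key: `hmass_decG` (SPEC's `hmass` at `u := 1`), `prod_card_decG_le_MULTOf`.  §4 `fibreMass_of_genDecoration`.  §5 a
decided toy (a two-event genealogy decorated by flag words of a one-cube set over one level: `16 = 4·4 = ncount`).

HONEST SCOPE.  Bookkeeping over OUR carriers.  Which cube set `Q` and which window length `m` an event of a member
reads (the instantiation `C K w e := flagWords (Q K w e) (m K e)` or finer), the map `dec` and its two displays
`hmem`∕`hinj` are the READING (ρ1) — an identification of `HistRead`'s class, true by inspection once (1.72)'s index is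
Bałaban's, nothing provable before; (ρ2) is the curly∕last-exponent envelope reading; (ρ3) is kernel HERE modulo the
share letters (NEEDS-CONSTANT FIBRE-1, served by the refuter's v18 F97 in the crude currency).  BY-NAME EFFECT ON THE
WALL: NONE by this file alone — the custodian's `IndexDecor` ∕ record twin (SPEC §2∕§3) is where `hρ` is replaced; this
file is an E-side supplier it instantiates.  NE7b NOT PRINTED ∕ NOT PROVED; spine 0∕9.  HONEST DEPENDENCY (cell):
continuum YM on T⁴ ⇐ BetaPertH ∧ nine spine estimates (0/9 proved); BetaPertH ⇐ (D1) ∧ (D4) ∧ CAP+tail; G-an2-4 gates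
asym, D1 and NE2/3/4.  This file changes none of it.
-/

open Finset
open Literature.MathematicalPhysics.QuantumFieldTheory.Balaban1983to89
open T4PersistenceDictionary T4LiveClassFibration
open Summit.QuantumFields.BalabanUV.T4Continuum.HistoryPriceNodeSum
open Summit.QuantumFields.BalabanUV.T4Continuum.HistoryPriceKeys
open Summit.QuantumFields.BalabanUV.T4Continuum.HistoryBankingFibreResum
open Summit.QuantumFields.BalabanUV.T4Continuum.ZoneSkeleton (gmap)

namespace Summit.QuantumFields.BalabanUV.T4Continuum.HistoryBankingFibreDecorKeys

noncomputable section

/-! ## §1 Words over a finite alphabet; the cube-subset and cube-flag words of the crude currency -/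

section Words

variable {β : Type*} [DecidableEq β]

/-- **WORDS OF LENGTH `m` OVER A FINITE ALPHABET `S`** (one letter per level of a window of `m` levels). [folklore] -/
def words (S : Finset β) : ℕ → Finset (List β)
  | 0 => {[]}
  | m + 1 => (S ×ˢ words S m).image fun p => p.1 :: p.2

/-- the empty word is the only word of length `0` [folklore] -/
@[simp] theorem words_zero (S : Finset β) : words S 0 = {[]} := rfl
/-- words of length `m + 1`: a first letter and a word of length `m` [folklore] -/
theorem words_succ (S : Finset β) (m : ℕ) : words S (m + 1) = (S ×ˢ words S m).image fun p => p.1 :: p.2 := rfl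

omit [DecidableEq β] in
/-- consing is injective on (letter, word) pairs [folklore] -/
theorem cons_pair_injective : Function.Injective fun p : β × List β => p.1 :: p.2 :=
  fun _ _ h => Prod.ext (List.cons.inj h).1 (List.cons.inj h).2

/-- **THE NUMBER OF WORDS** of length `m` over `S` is `#S ^ m`. [folklore] -/
theorem card_words (S : Finset β) : ∀ m, (words S m).card = S.card ^ m
  | 0 => by simp
  | m + 1 => by
    rw [words_succ, Finset.card_image_of_injective _ cons_pair_injective, Finset.card_product, card_words S m,
      pow_succ, mul_comm]

/-- a word of `words S m` has length `m` and letters in `S` [folklore] -/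
theorem length_eq_and_mem_of_mem_words {S : Finset β} :
    ∀ {m : ℕ} {l : List β}, l ∈ words S m → l.length = m ∧ ∀ x ∈ l, x ∈ S
  | 0, l, h => by
    rw [words_zero, Finset.mem_singleton] at h
    subst h
    simp
  | m + 1, l, h => by
    rw [words_succ, Finset.mem_image] at h
    obtain ⟨p, hp, rfl⟩ := h
    obtain ⟨h1, h2⟩ := Finset.mem_product.1 hp
    obtain ⟨hl, hS⟩ := length_eq_and_mem_of_mem_words h2
    refine ⟨by rw [List.length_cons, hl], fun x hx => ?_⟩
    rcases List.mem_cons.1 hx with rfl | hx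
    · exact h1
    · exact hS x hx

/-- a list with letters in `S` is a word of its own length [folklore] -/
theorem mem_words_of {S : Finset β} : ∀ {l : List β}, (∀ x ∈ l, x ∈ S) → l ∈ words S l.length
  | [], _ => by simp
  | x :: l, h => by
    rw [List.length_cons, words_succ, Finset.mem_image]
    exact ⟨(x, l), Finset.mem_product.2 ⟨h x List.mem_cons_self,
      mem_words_of fun y hy => h y (List.mem_cons_of_mem _ hy)⟩, rfl⟩

variable {α : Type*} [DecidableEq α]

/-- **CUBE-SUBSET WORDS**: per level of a window of `m` levels, ONE subset of the member's cube set `Q` (e.g. the cubes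
newly flagged by a renewal). [folklore] -/
def subWords (Q : Finset α) (m : ℕ) : Finset (List (Finset α)) := words Q.powerset m

/-- **CUBE-FLAG WORDS**: per level of a window of `m` levels, a PAIR of subsets of the member's cube set `Q` — the pair
`(Ω^c_j ∩ X, Z_j ∩ X)` of (1.71) p. 378 at one level `j` (locator; which sets are a choice and which are determined by
S, p. 384, is the reading's). [folklore] -/
def flagWords (Q : Finset α) (m : ℕ) : Finset (List (Finset α × Finset α)) := words (Q.powerset ×ˢ Q.powerset) m

/-- `#(subWords Q m) = 2 ^ (#Q · m)` [folklore] -/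
theorem card_subWords (Q : Finset α) (m : ℕ) : (subWords Q m).card = 2 ^ (Q.card * m) := by
  rw [subWords, card_words, Finset.card_powerset, ← pow_mul]

/-- `#(flagWords Q m) = 4 ^ (#Q · m)` (the owner's `card_powerset_prod_powerset` per level) [folklore] -/
theorem card_flagWords (Q : Finset α) (m : ℕ) : (flagWords Q m).card = 4 ^ (Q.card * m) := by
  rw [flagWords, card_words, card_powerset_prod_powerset, ← pow_mul]

/-- **THE SHARE LETTER OF THE SUBSET WORDS**: `#Q · m · log 2 ≤ φ` gives `#(subWords Q m) ≤ exp φ`. [folklore] -/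
theorem card_subWords_le_exp {Q : Finset α} {m : ℕ} {φ : ℝ} (h : ((Q.card * m : ℕ) : ℝ) * Real.log 2 ≤ φ) :
    ((subWords Q m).card : ℝ) ≤ Real.exp φ := by
  rw [card_subWords]; push_cast; exact two_pow_le_exp h

/-- **THE SHARE LETTER OF THE FLAG WORDS** (FIBRE-1's shape, crude currency): `#Q · m · log 4 ≤ φ` gives
`#(flagWords Q m) ≤ exp φ`. [folklore] -/
theorem card_flagWords_le_exp {Q : Finset α} {m : ℕ} {φ : ℝ} (h : ((Q.card * m : ℕ) : ℝ) * Real.log 4 ≤ φ) :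
    ((flagWords Q m).card : ℝ) ≤ Real.exp φ := by
  rw [card_flagWords]; push_cast; exact four_pow_le_exp h

/-- the empty cube set affords exactly one flag word of every length (an event reading no cube costs no share:
`#· = 1 = exp 0`) [folklore] -/
theorem card_flagWords_empty (m : ℕ) : (flagWords (∅ : Finset α) m).card = 1 := by
  rw [card_flagWords, Finset.card_empty, zero_mul, pow_zero]

end Words

/-! ## §2 The decorations of a member: its genealogy decorated node by node -/

section DecG

variable {ε β : Type*} [DecidableEq ε] [DecidableEq β]

/-- **THE DECORATIONS OF A GENEALOGY** `G` by per-event choice sets `C`: the genealogies of the SAME SHAPE as `G` whose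
every node `e` carries, next to its event, a letter of `C e` — a birth node `born (b, x) j` with `x ∈ C b`, a renewal
node `renew · (e, x) h` with `x ∈ C e`, a merger node likewise.  The decoration of a key member `w` beyond the key is a
member of `decG (C w) w.2.1` ((1.71)'s per-component admissible sub-sequences, one word per event of the member —
locator; WHICH words is the reading's `C`). [folklore] -/
def decG (C : ε → Finset β) : Gen ε → Finset (Gen (ε × β))
  | Gen.born b j => (C b).image fun x => Gen.born (b, x) j
  | Gen.renew G e h => (decG C G ×ˢ C e).image fun p => Gen.renew p.1 (e, p.2) h
  | Gen.merge X Y e => ((decG C X ×ˢ decG C Y) ×ˢ C e).image fun p => Gen.merge p.1.1 p.1.2 (e, p.2)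

/-- decorations of a bare birth [folklore] -/
theorem decG_born (C : ε → Finset β) (b : ε) (j : ℕ) :
    decG C (Gen.born b j) = (C b).image fun x => Gen.born (b, x) j := rfl
/-- decorations after a renewal [folklore] -/
theorem decG_renew (C : ε → Finset β) (G : Gen ε) (e : ε) (h : ℕ) :
    decG C (Gen.renew G e h) = (decG C G ×ˢ C e).image fun p => Gen.renew p.1 (e, p.2) h := rfl
/-- decorations after a merger [folklore] -/
theorem decG_merge (C : ε → Finset β) (X Y : Gen ε) (e : ε) :
    decG C (Gen.merge X Y e) = ((decG C X ×ˢ decG C Y) ×ˢ C e).image fun p => Gen.merge p.1.1 p.1.2 (e, p.2) := rfl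

/-- **THE COUNT OF THE DECORATIONS IS EXACTLY THE OWNER's NODE COUNT**: `#(decG C G) = ncount (#C ·) G` — SPEC IR-49-1
§2's display `#(Dec w) ≤ ncount N w.2.1` holds with EQUALITY at `Dec w := decG C w.2.1`, `N := (#C ·)`. [folklore] -/
theorem card_decG_eq_ncount (C : ε → Finset β) :
    ∀ G : Gen ε, (decG C G).card = ncount (fun e => (C e).card) G
  | Gen.born b j => by
    rw [decG_born, Finset.card_image_of_injective, ncount_born]
    intro x y h
    exact (Prod.mk.inj (Gen.born.inj h).1).2
  | Gen.renew G e hh => by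
    rw [decG_renew, Finset.card_image_of_injective, Finset.card_product, card_decG_eq_ncount C G, ncount_renew]
    intro p q h
    obtain ⟨h1, h2, -⟩ := Gen.renew.inj h
    exact Prod.ext h1 (Prod.mk.inj h2).2
  | Gen.merge X Y e => by
    rw [decG_merge, Finset.card_image_of_injective, Finset.card_product, Finset.card_product,
      card_decG_eq_ncount C X, card_decG_eq_ncount C Y, ncount_merge]
    intro p q h
    obtain ⟨h1, h2, h3⟩ := Gen.merge.inj h
    exact Prod.ext (Prod.ext h1 h2) (Prod.mk.inj h3).2

/-- **A DECORATION PROJECTS TO THE MEMBER's GENEALOGY**: forgetting the letters (`gmap Prod.fst`) returns `G`.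
[folklore] -/
theorem gmap_fst_of_mem_decG (C : ε → Finset β) :
    ∀ {G : Gen ε} {G' : Gen (ε × β)}, G' ∈ decG C G → gmap Prod.fst G' = G
  | Gen.born b j, G', h => by
    rw [decG_born, Finset.mem_image] at h
    obtain ⟨x, -, rfl⟩ := h
    rfl
  | Gen.renew G e hh, G', h => by
    rw [decG_renew, Finset.mem_image] at h
    obtain ⟨p, hp, rfl⟩ := h
    have hG := gmap_fst_of_mem_decG C (Finset.mem_product.1 hp).1
    show Gen.renew (gmap Prod.fst p.1) e hh = Gen.renew G e hh
    rw [hG]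
  | Gen.merge X Y e, G', h => by
    rw [decG_merge, Finset.mem_image] at h
    obtain ⟨p, hp, rfl⟩ := h
    obtain ⟨hp1, -⟩ := Finset.mem_product.1 hp
    obtain ⟨hX, hY⟩ := Finset.mem_product.1 hp1
    show Gen.merge (gmap Prod.fst p.1.1) (gmap Prod.fst p.1.2) e = Gen.merge X Y e
    rw [gmap_fst_of_mem_decG C hX, gmap_fst_of_mem_decG C hY]

/-- **THE LETTER AT A NODE IS DRAWN FROM THAT EVENT's CHOICE SET**: every node `(e, x)` of a decoration has `x ∈ C e`.
[folklore] -/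
theorem snd_mem_of_mem_decG (C : ε → Finset β) :
    ∀ {G : Gen ε} {G' : Gen (ε × β)}, G' ∈ decG C G → ∀ n ∈ G'.events, n.2 ∈ C n.1
  | Gen.born b j, G', h => by
    rw [decG_born, Finset.mem_image] at h
    obtain ⟨x, hx, rfl⟩ := h
    intro n hn
    rw [Gen.events_born, Finset.mem_singleton] at hn
    subst hn
    exact hx
  | Gen.renew G e hh, G', h => by
    rw [decG_renew, Finset.mem_image] at h
    obtain ⟨p, hp, rfl⟩ := h
    obtain ⟨h1, h2⟩ := Finset.mem_product.1 hp
    intro n hn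
    rw [Gen.events_renew, Finset.mem_insert] at hn
    rcases hn with rfl | hn
    · exact h2
    · exact snd_mem_of_mem_decG C h1 n hn
  | Gen.merge X Y e, G', h => by
    rw [decG_merge, Finset.mem_image] at h
    obtain ⟨p, hp, rfl⟩ := h
    obtain ⟨hp1, h3⟩ := Finset.mem_product.1 hp
    obtain ⟨hX, hY⟩ := Finset.mem_product.1 hp1
    intro n hn
    rw [Gen.events_merge, Finset.mem_insert, Finset.mem_union] at hn
    rcases hn with rfl | hn | hn
    · exact h3
    · exact snd_mem_of_mem_decG C hX n hn
    · exact snd_mem_of_mem_decG C hY n hn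

/-- the events of a decoration project onto the member's events [folklore] -/
theorem fst_mem_events_of_mem_decG (C : ε → Finset β) {G : Gen ε} {G' : Gen (ε × β)} (h : G' ∈ decG C G) :
    ∀ n ∈ G'.events, n.1 ∈ G.events := by
  intro n hn
  have := ZoneSkeleton.events_gmap (Prod.fst : ε × β → ε) G'
  rw [gmap_fst_of_mem_decG C h] at this
  rw [this]
  exact Finset.mem_image_of_mem _ hn

/-- **THE NODE COUNT AGAINST THE SHARES, ASKED ON THE GENEALOGY's OWN EVENTS ONLY** (the owner's `ncount_le_exp_nsum`
with its per-event hypothesis restricted to `G.events`): `∀ e ∈ G.events, N e ≤ exp (φ e)` ⇒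
`ncount N G ≤ exp (nsum φ G)`.
At a node where the share letter is `0` (a merger: `sharpT = 0`) the hypothesis reads `N e ≤ 1`. [folklore] -/
theorem ncount_le_exp_nsum_of_events (N : ε → ℕ) (φ : ε → ℝ) :
    ∀ G : Gen ε, (∀ e ∈ G.events, (N e : ℝ) ≤ Real.exp (φ e)) → (ncount N G : ℝ) ≤ Real.exp (nsum φ G)
  | Gen.born b _, h => by simpa using h b (by simp)
  | Gen.renew G e _, h => by
    rw [ncount_renew, nsum_renew, Nat.cast_mul, Real.exp_add]
    exact mul_le_mul (ncount_le_exp_nsum_of_events N φ G fun e' he' => h e' (by simp [he']))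
      (h e (by simp)) (Nat.cast_nonneg _) (Real.exp_nonneg _)
  | Gen.merge X Y e, h => by
    rw [ncount_merge, nsum_merge, Nat.cast_mul, Nat.cast_mul, Real.exp_add, Real.exp_add]
    exact mul_le_mul (mul_le_mul (ncount_le_exp_nsum_of_events N φ X fun e' he' => h e' (by simp [he']))
      (ncount_le_exp_nsum_of_events N φ Y fun e' he' => h e' (by simp [he'])) (Nat.cast_nonneg _)
      (Real.exp_nonneg _)) (h e (by simp)) (Nat.cast_nonneg _) (by positivity)

/-- **THE NODE COUNT IS MONOTONE IN THE PER-EVENT COUNTS ON THE GENEALOGY's EVENTS** (a member-dependent count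
`#(C w e)` below a member-free letter `N e`, e.g. one reading only the event's class `e.fat`). [folklore] -/
theorem ncount_mono_of_events (N N' : ε → ℕ) :
    ∀ G : Gen ε, (∀ e ∈ G.events, N e ≤ N' e) → ncount N G ≤ ncount N' G
  | Gen.born b _, h => by simpa using h b (by simp)
  | Gen.renew G e _, h => by
    rw [ncount_renew, ncount_renew]
    exact Nat.mul_le_mul (ncount_mono_of_events N N' G fun e' he' => h e' (by simp [he'])) (h e (by simp))
  | Gen.merge X Y e, h => by
    rw [ncount_merge, ncount_merge]
    exact Nat.mul_le_mul (Nat.mul_le_mul (ncount_mono_of_events N N' X fun e' he' => h e' (by simp [he']))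
      (ncount_mono_of_events N N' Y fun e' he' => h e' (by simp [he']))) (h e (by simp))

/-- **(ρ3), CRUDE CURRENCY, PER MEMBER**: per-event letters `#(C e) ≤ exp (φ e)` on the genealogy's events give
`#(decG C G) ≤ exp (nsum φ G)`. [folklore] -/
theorem card_decG_le_exp_nsum (C : ε → Finset β) (φ : ε → ℝ) (G : Gen ε)
    (h : ∀ e ∈ G.events, ((C e).card : ℝ) ≤ Real.exp (φ e)) : ((decG C G).card : ℝ) ≤ Real.exp (nsum φ G) := by
  rw [card_decG_eq_ncount]
  exact ncount_le_exp_nsum_of_events _ φ G h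

/-- the same as a unit-weight sum (the shape of SPEC's `hmass` at `u := 1`) [folklore] -/
theorem sum_one_decG_le_exp_nsum (C : ε → Finset β) (φ : ε → ℝ) (G : Gen ε)
    (h : ∀ e ∈ G.events, ((C e).card : ℝ) ≤ Real.exp (φ e)) :
    ∑ _x ∈ decG C G, (1 : ℝ) ≤ Real.exp (nsum φ G) := by
  rw [Finset.sum_const, nsmul_eq_mul, mul_one]
  exact card_decG_le_exp_nsum C φ G h

end DecG

/-! ## §3 On a key: the per-member masses of SPEC IR-49-1 §2 at `Dec K w := decG (C K w) w.2.1`, `u := 1` -/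

section Key

variable {γ δ' β : Type*} [DecidableEq β]

/-- **SPEC's `hmass` IN THE CRUDE CURRENCY**: for every member `w` of the key, per-event letters on ITS events give
`Σ_{x ∈ decG (C w) w.2.1} 1 ≤ exp (nsum φ w.2.1)`. [folklore] -/
theorem hmass_decG (φ : PEv → ℝ) (k : Finset (γ × Gen PEv × δ')) (C : γ × Gen PEv × δ' → PEv → Finset β)
    (hC : ∀ w ∈ k, ∀ e ∈ w.2.1.events, ((C w e).card : ℝ) ≤ Real.exp (φ e)) :
    ∀ w ∈ k, ∑ _x ∈ decG (C w) w.2.1, (1 : ℝ) ≤ Real.exp (nsum φ w.2.1) :=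
  fun w hw => sum_one_decG_le_exp_nsum (C w) φ w.2.1 (hC w hw)

/-- the pure count against the key letter: `∏_{w ∈ k} #(decG (C w) w.2.1) ≤ MULTOf φ k` [folklore] -/
theorem prod_card_decG_le_MULTOf (φ : PEv → ℝ) (k : Finset (γ × Gen PEv × δ'))
    (C : γ × Gen PEv × δ' → PEv → Finset β)
    (hC : ∀ w ∈ k, ∀ e ∈ w.2.1.events, ((C w e).card : ℝ) ≤ Real.exp (φ e)) :
    ∏ w ∈ k, ((decG (C w) w.2.1).card : ℝ) ≤ MULTOf φ k :=
  prod_card_le_MULTOf φ k (fun w => decG (C w) w.2.1) fun w hw => card_decG_le_exp_nsum (C w) φ w.2.1 (hC w hw)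

end Key

/-! ## §4 THE ASSEMBLED JUNCTION over any term type: (ρ) from a genealogy decoration, crude currency -/

section Junction

variable {ι γ δ' β κ : Type*} [DecidableEq γ] [DecidableEq δ'] [DecidableEq β]

/-- **(ρ) `FibreMass` FROM A GENEALOGY DECORATION OF THE KEY FIBRE, CRUDE CURRENCY** — the owner's
`fibreMass_of_decoration` at `Dec w := decG (C w) w.2.1`, `u := 1`; conclusion LITERALLY `hρ`'s shape at one cutoff and
class.  Remaining hypotheses: (ρ1) the displayed decoration `dec τ w ∈ decG (C w) w.2.1` of every fibre term at every
member, a slice `slice τ ∈ Csl`, and their JOINT INJECTIVITY on the fibre; (ρ2) the slice envelope `v ≥ 0`,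
`Σ_{c ∈ Csl} v c ≤ W` and `dmass τ ≤ v (slice τ)` (with (ρ0) inside: no dead factor); (ρ3)'s letters
`#(C w e) ≤ exp (φ e)` on every member's events. [folklore] -/
theorem fibreMass_of_genDecoration (kmem : ℕ → ι → Finset (γ × Gen PEv × δ')) (T : ℕ → Finset ι) (K : ℕ)
    (k : Finset (γ × Gen PEv × δ')) (dmass : ι → ℝ) (φ : PEv → ℝ) {W : ℝ}
    (C : γ × Gen PEv × δ' → PEv → Finset β) (dec : ι → γ × Gen PEv × δ' → Gen (PEv × β))
    (Csl : Finset κ) (slice : ι → κ) {v : κ → ℝ} (hv : ∀ c ∈ Csl, 0 ≤ v c) (hW : ∑ c ∈ Csl, v c ≤ W)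
    (hsl : ∀ τ ∈ fibre kmem T K k, slice τ ∈ Csl)
    (hmem : ∀ τ ∈ fibre kmem T K k, ∀ w ∈ k, dec τ w ∈ decG (C w) w.2.1)
    (hinj : ∀ τ ∈ fibre kmem T K k, ∀ τ' ∈ fibre kmem T K k,
      slice τ = slice τ' → (∀ w ∈ k, dec τ w = dec τ' w) → τ = τ')
    (hfac : ∀ τ ∈ fibre kmem T K k, dmass τ ≤ v (slice τ))
    (hC : ∀ w ∈ k, ∀ e ∈ w.2.1.events, ((C w e).card : ℝ) ≤ Real.exp (φ e)) :
    ∑ τ ∈ fibre kmem T K k, dmass τ ≤ W * MULTOf φ k :=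
  fibreMass_of_decoration kmem T K k dmass φ (fun w => decG (C w) w.2.1) dec Csl slice hv hW
    (u := fun _ _ => (1 : ℝ)) (fun _ _ _ _ => zero_le_one) hsl hmem hinj
    (fun τ hτ => by simpa using hfac τ hτ) (hmass_decG φ k C hC)

end Junction

/-! ## §5 A decided toy: a two-event genealogy decorated by flag words of a one-cube set over one level -/

section Toy

/-- the toy genealogy: a birth `(0,0,1)` at step `0` renewed by `(1,1,0)` at readiness step `0` [folklore] -/
def toyG : Gen PEv := Gen.renew (Gen.born ((0, 0, 1) : PEv) 0) ((1, 1, 0) : PEv) 0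

/-- the toy choice sets: flag words of the one-cube set `{0}` over one level at every event [folklore] -/
def toyC : PEv → Finset (List (Finset (Fin 1) × Finset (Fin 1))) := fun _ => flagWords ({0} : Finset (Fin 1)) 1

/-- every toy choice set has `4` letters [folklore] -/
theorem card_toyC (e : PEv) : (toyC e).card = 4 := by
  rw [toyC, card_flagWords, Finset.card_singleton]; norm_num

/-- **THE TOY COUNT**: `16` decorations, `= ncount (#C ·) = 4 · 4`. [folklore] -/
theorem card_decG_toy : (decG toyC toyG).card = 16 := by
  rw [card_decG_eq_ncount, toyG, ncount_renew, ncount_born, card_toyC, card_toyC]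

end Toy

end

end Summit.QuantumFields.BalabanUV.T4Continuum.HistoryBankingFibreDecorKeys
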